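import Summits.Ventures.HSemireg.WedgeHankelRecurrenceRouthHurwitzDeterminants

/-!
# Venture HSemireg — THE ROUTH–HURWITZ DETERMINANT CONDITIONS WRITTEN OUT IN DEGREES 2, 3, 4 (Gantmacher Ch. XV §6 (32)/(36) specialised; Hairer–Nørsett–Wanner I (13.13) «stability iff
# `p > 0, pq − r > 0, (pq − r)r − p²s > 0, s > 0`» for `z⁴ + pz³ + qz² + rz + s`): for a real polynomial with positive leading coefficient, all roots lie in `Re z < 0` iff
# (deg 2) `a_1, a_2 > 0`; (deg 3) `a_1 > 0, a_1a_2 − a_0a_3 > 0, a_3 > 0`; (deg 4) `a_1 > 0, a_1a_2 − a_0a_3 > 0, (a_1a_2 − a_0a_3)a_3 − a_1²a_4 > 0, a_4 > 0` — corollaries of N211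

HONEST FRAMING. Part of the Lean index of the computation cell `pub-hsemireg` (seat p10 gen 39, Sunday typer «UNIFORM-IN-n»).
EXPLICIT 1×1 ∕ 2×2 ∕ 3×3 DETERMINANTS AND ROOTS OF REAL POLYNOMIALS ONLY: no variety, no cohomology theory, no sheaf, no Ext group and no semiregularity map is constructed here; nothing here says
that HC / HC_CM / HC_AV holds; no Literature fact (unproved `Prop`) is declared or used.  Custodian versions as in `WedgeHankelSiegelIdeal` (1/3).
SOURCES (cited).  Gantmacher, *The Theory of Matrices* Ch. XV §6 (32) `Δ_1 = a_1, Δ_2 = |a_1 a_3; a_0 a_2|, …` and (36); E. Hairer, S. P. Nørsett, G. Wanner, *Solving ODE I* §I.13 Example 2 (Routh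
1877, p. 27) (13.13) «Express the stability conditions for the biquadratic `z⁴ + pz³ + qz² + rz + s = 0`. … We have stability iff `p > 0, pq − r > 0, (pq − r)r − p²s > 0, s > 0`.» (typed by
hand in Literature `Analysis/ODE/RouthHurwitzLowOrder.quartic_iff` for monic quartics with the roots quantified pointwise; Exercise 1 b) for cubics = N196 `forall_re_neg_cubic_iff`).
DEDUP DISCLOSURE (`rg` + `lean search`, 2026-09-02): N196 has degrees 2 and 3 for MONIC `X² + aX + b`, `X³ + aX² + bX + c` (from the two-Bezoutian criterion; NOT restated here — the statements
below are for arbitrary positive leading coefficient in terms of `p.coeff`, and the explicit monic QUARTIC); Literature `RouthHurwitzLowOrder` states degrees 2–4 for monic polynomials with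
`∀ z : ℂ, z^4 + … = 0 → z.re < 0` (a different rendering; not imported — `import Mathlib` closure).  The 10 names below: 0 hits tree-wide.

WHAT IS IN THE TREE.  N211: `forall_re_neg_iff_forall_det_hurwitzMatrix_pos`; N210: `hurwitzMatrix_eq_hurwitzSeqMatrix_reverse`, `det_hurwitzSeqMatrix_one ∕ _two ∕ _three`,
`det_hurwitzSeqMatrix_succ_of_eq_zero`.  Mathlib: `Polynomial.coeff_reverse`, `Polynomial.revAt_le`, `Matrix.det_fin_zero`.
THIS FILE (namespace `Summit.Ventures.HSemireg.Wedge.HankelOuter` continued; CHAINED on N211; 0 definitions):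
* §926 THE HURWITZ DETERMINANTS IN LOW DEGREE (any commutative ring, `p.coeff`): `det_hurwitzMatrix_one_eq` (`Δ_1 = p_{n−1}`), `det_hurwitzMatrix_two_of_natDegree_two` (`Δ_2 = p_1p_0`),
  `det_hurwitzMatrix_two_eq` (`deg ≥ 3`: `Δ_2 = a_1a_2 − a_0a_3`), `det_hurwitzMatrix_three_of_natDegree_four` (`Δ_3 = a_1a_2a_3 − a_1²a_4 − a_0a_3²`), `det_hurwitzMatrix_four_of_natDegree_four`
  (`Δ_4 = a_4 Δ_3`), `det_hurwitzMatrix_three_of_natDegree_three` (`Δ_3 = a_3 Δ_2`).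
* §927 THE CRITERIA: **`forall_re_neg_iff_of_natDegree_two`** (`a_0 > 0`: Hurwitz ⟺ `a_1 > 0 ∧ a_2 > 0`), **`forall_re_neg_iff_of_natDegree_three`** (⟺ `a_1 > 0 ∧ a_1a_2 − a_0a_3 > 0 ∧ a_3 > 0`),
  **`forall_re_neg_iff_of_natDegree_four`** (⟺ `a_1 > 0 ∧ a_1a_2 − a_0a_3 > 0 ∧ (a_1a_2 − a_0a_3)a_3 − a_1²a_4 > 0 ∧ a_4 > 0`), **`forall_re_neg_quartic_iff`** (HNW (13.13) for `X⁴ + pX³ + qX² + rX + s`).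
CAVEATS.  Coefficients are named descending in the docstrings (`a_k = p.coeff (n − k)`) and ascending (`p.coeff k`) in the statements.  Nothing Ext-side.  New names only.
-/

open Module Polynomial
open scoped Matrix Polynomial

namespace Summit.Ventures.HSemireg.Wedge.HankelOuter

open Summit.Ventures.HSemireg.Wedge Summit.Ventures.HSemireg.Wedge.Hankel

/-! ## §926. The Hurwitz determinants in low degree -/

section Dets

variable {R : Type*} [CommRing R]

/-- `Δ_1 = a_1 = p_{n−1}` (`deg p = n ≥ 1`; N210 restated with `p.coeff`). [Gantmacher (32); this file, §926] -/
theorem det_hurwitzMatrix_one_eq {n : ℕ} {p : R[X]} (hp : p.natDegree = n + 1) : (hurwitzMatrix 1 p).det = p.coeff n := by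
  rw [det_hurwitzMatrix_one (by omega), hp, Nat.add_sub_cancel]

/-- `Δ_2 = a_1a_2 − a_0a_3` with `a_3 = 0` in degree `2`: `Δ_2 = p_1 p_0` for `deg p = 2`. [Gantmacher (32); this file, §926] -/
theorem det_hurwitzMatrix_two_of_natDegree_two {p : R[X]} (hp : p.natDegree = 2) : (hurwitzMatrix 2 p).det = p.coeff 1 * p.coeff 0 := by
  rw [hurwitzMatrix_eq_hurwitzSeqMatrix_reverse, det_hurwitzSeqMatrix_two, coeff_reverse, coeff_reverse, coeff_reverse, coeff_reverse, hp, revAt_le (by omega), revAt_le (by omega),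
    revAt_le (by omega), revAt_eq_self_of_lt (by omega), coeff_eq_zero_of_natDegree_lt (show p.natDegree < 3 by omega), mul_zero, sub_zero]

/-- `Δ_2 = a_1a_2 − a_0a_3` (`deg p = n ≥ 3`, ascending: `p_{n−1}p_{n−2} − p_n p_{n−3}`). [Gantmacher (32); this file, §926] -/
theorem det_hurwitzMatrix_two_eq {n : ℕ} {p : R[X]} (hp : p.natDegree = n + 3) : (hurwitzMatrix 2 p).det = p.coeff (n + 2) * p.coeff (n + 1) - p.coeff (n + 3) * p.coeff n := by
  rw [det_hurwitzMatrix_two (by omega), hp, show n + 3 - 1 = n + 2 by omega, show n + 3 - 2 = n + 1 by omega, Nat.add_sub_cancel]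

/-- **`Δ_3 = a_1a_2a_3 − a_1²a_4 − a_0a_3²` for a quartic** (`a_5 = 0`; ascending: `p_3p_2p_1 − p_3²p_0 − p_4p_1²`). [Gantmacher (32); this file, §926] -/
theorem det_hurwitzMatrix_three_of_natDegree_four {p : R[X]} (hp : p.natDegree = 4) :
    (hurwitzMatrix 3 p).det = p.coeff 3 * p.coeff 2 * p.coeff 1 - p.coeff 3 ^ 2 * p.coeff 0 - p.coeff 4 * p.coeff 1 ^ 2 := by
  rw [hurwitzMatrix_eq_hurwitzSeqMatrix_reverse, det_hurwitzSeqMatrix_three]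
  simp only [coeff_reverse, hp, revAt_le (show 0 ≤ 4 by omega), revAt_le (show 1 ≤ 4 by omega), revAt_le (show 2 ≤ 4 by omega), revAt_le (show 3 ≤ 4 by omega), revAt_le (show 4 ≤ 4 by omega),
    revAt_eq_self_of_lt (show 4 < 5 by omega), coeff_eq_zero_of_natDegree_lt (show p.natDegree < 5 by omega)]
  ring

/-- **`Δ_4 = a_4 · Δ_3` for a quartic** (last-column rule). [Gantmacher (32); this file, §926] -/
theorem det_hurwitzMatrix_four_of_natDegree_four {p : R[X]} (hp : p.natDegree = 4) : (hurwitzMatrix 4 p).det = p.coeff 0 * (hurwitzMatrix 3 p).det := by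
  rw [hurwitzMatrix_eq_hurwitzSeqMatrix_reverse, hurwitzMatrix_eq_hurwitzSeqMatrix_reverse, det_hurwitzSeqMatrix_succ_of_eq_zero 3 (c := p.reverse.coeff) fun m hm => ?_, coeff_reverse, hp,
    revAt_le le_rfl, Nat.sub_self]
  rw [coeff_reverse, hp, revAt_eq_self_of_lt hm]
  exact coeff_eq_zero_of_natDegree_lt (by omega)

/-- `Δ_3 = a_3 · Δ_2` for a cubic (last-column rule). [Gantmacher (32); this file, §926] -/
theorem det_hurwitzMatrix_three_of_natDegree_three {p : R[X]} (hp : p.natDegree = 3) : (hurwitzMatrix 3 p).det = p.coeff 0 * (hurwitzMatrix 2 p).det := by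
  rw [hurwitzMatrix_eq_hurwitzSeqMatrix_reverse, hurwitzMatrix_eq_hurwitzSeqMatrix_reverse, det_hurwitzSeqMatrix_succ_of_eq_zero 2 (c := p.reverse.coeff) fun m hm => ?_, coeff_reverse, hp,
    revAt_le le_rfl, Nat.sub_self]
  rw [coeff_reverse, hp, revAt_eq_self_of_lt hm]
  exact coeff_eq_zero_of_natDegree_lt (by omega)

end Dets

/-! ## §927. The criteria in degrees 2, 3, 4 -/

/-- **Degree 2 (`p_2 > 0`): all roots in `Re z < 0` iff `p_1 > 0` and `p_0 > 0`.** [Gantmacher (36), n = 2; this file, §927] -/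
theorem forall_re_neg_iff_of_natDegree_two {p : ℝ[X]} (hp : p.natDegree = 2) (h2 : 0 < p.coeff 2) :
    (∀ z ∈ (p.map (algebraMap ℝ ℂ)).roots, z.re < 0) ↔ 0 < p.coeff 1 ∧ 0 < p.coeff 0 := by
  rw [forall_re_neg_iff_forall_det_hurwitzMatrix_pos hp (by rwa [leadingCoeff, hp])]
  constructor
  · intro h
    have h1 : 0 < p.coeff 1 := by have := h 1 (by omega); rwa [det_hurwitzMatrix_one_eq hp] at this
    have h12 : 0 < p.coeff 1 * p.coeff 0 := by have := h 2 le_rfl; rwa [det_hurwitzMatrix_two_of_natDegree_two hp] at this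
    exact ⟨h1, (mul_pos_iff_of_pos_left h1).1 h12⟩
  · rintro ⟨h1, h0⟩ k hk
    interval_cases k
    · rw [Matrix.det_fin_zero]; exact one_pos
    · rw [det_hurwitzMatrix_one_eq hp]; exact h1
    · rw [det_hurwitzMatrix_two_of_natDegree_two hp]; exact mul_pos h1 h0

/-- **Degree 3 (`a_0 = p_3 > 0`): all roots in `Re z < 0` iff `a_1 > 0`, `a_1a_2 − a_0a_3 > 0`, `a_3 > 0`** — ascending: `p_2 > 0 ∧ p_2p_1 − p_3p_0 > 0 ∧ p_0 > 0`. [Gantmacher (36), n = 3; this file, §927] -/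
theorem forall_re_neg_iff_of_natDegree_three {p : ℝ[X]} (hp : p.natDegree = 3) (h3 : 0 < p.coeff 3) :
    (∀ z ∈ (p.map (algebraMap ℝ ℂ)).roots, z.re < 0) ↔ 0 < p.coeff 2 ∧ 0 < p.coeff 2 * p.coeff 1 - p.coeff 3 * p.coeff 0 ∧ 0 < p.coeff 0 := by
  have hΔ1 : (hurwitzMatrix 1 p).det = p.coeff 2 := det_hurwitzMatrix_one_eq hp
  have hΔ2 : (hurwitzMatrix 2 p).det = p.coeff 2 * p.coeff 1 - p.coeff 3 * p.coeff 0 := det_hurwitzMatrix_two_eq (n := 0) hp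
  have hΔ3 := det_hurwitzMatrix_three_of_natDegree_three hp
  rw [forall_re_neg_iff_forall_det_hurwitzMatrix_pos hp (by rwa [leadingCoeff, hp])]
  constructor
  · intro h
    have h1 := h 1 (by omega); have h2 := h 2 (by omega); have h3' := h 3 le_rfl
    rw [hΔ1] at h1; rw [hΔ2] at h2; rw [hΔ3, hΔ2] at h3'
    exact ⟨h1, h2, (mul_pos_iff_of_pos_right h2).1 h3'⟩
  · rintro ⟨h1, h2, h0⟩ k hk
    interval_cases k
    · rw [Matrix.det_fin_zero]; exact one_pos
    · rw [hΔ1]; exact h1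
    · rw [hΔ2]; exact h2
    · rw [hΔ3, hΔ2]; exact mul_pos h0 h2

/-- **Degree 4 (`a_0 = p_4 > 0`): all roots in `Re z < 0` iff `a_1 > 0`, `a_1a_2 − a_0a_3 > 0`, `(a_1a_2 − a_0a_3)a_3 − a_1²a_4 > 0`, `a_4 > 0`** — ascending:
`p_3 > 0 ∧ p_3p_2 − p_4p_1 > 0 ∧ (p_3p_2 − p_4p_1)p_1 − p_3²p_0 > 0 ∧ p_0 > 0`. [Gantmacher (36), n = 4; HNW (13.13); this file, §927] -/
theorem forall_re_neg_iff_of_natDegree_four {p : ℝ[X]} (hp : p.natDegree = 4) (h4 : 0 < p.coeff 4) :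
    (∀ z ∈ (p.map (algebraMap ℝ ℂ)).roots, z.re < 0) ↔
      0 < p.coeff 3 ∧ 0 < p.coeff 3 * p.coeff 2 - p.coeff 4 * p.coeff 1 ∧ 0 < (p.coeff 3 * p.coeff 2 - p.coeff 4 * p.coeff 1) * p.coeff 1 - p.coeff 3 ^ 2 * p.coeff 0 ∧ 0 < p.coeff 0 := by
  have hΔ1 : (hurwitzMatrix 1 p).det = p.coeff 3 := det_hurwitzMatrix_one_eq hp
  have hΔ2 : (hurwitzMatrix 2 p).det = p.coeff 3 * p.coeff 2 - p.coeff 4 * p.coeff 1 := det_hurwitzMatrix_two_eq (n := 1) hp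
  have hΔ3 : (hurwitzMatrix 3 p).det = (p.coeff 3 * p.coeff 2 - p.coeff 4 * p.coeff 1) * p.coeff 1 - p.coeff 3 ^ 2 * p.coeff 0 := by rw [det_hurwitzMatrix_three_of_natDegree_four hp]; ring
  have hΔ4 := det_hurwitzMatrix_four_of_natDegree_four hp
  rw [forall_re_neg_iff_forall_det_hurwitzMatrix_pos hp (by rwa [leadingCoeff, hp])]
  constructor
  · intro h
    have h1 := h 1 (by omega); have h2 := h 2 (by omega); have h3 := h 3 (by omega); have h4' := h 4 le_rfl
    rw [hΔ1] at h1; rw [hΔ2] at h2; rw [hΔ3] at h3; rw [hΔ4, hΔ3] at h4'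
    exact ⟨h1, h2, h3, (mul_pos_iff_of_pos_right h3).1 h4'⟩
  · rintro ⟨h1, h2, h3, h0⟩ k hk
    interval_cases k
    · rw [Matrix.det_fin_zero]; exact one_pos
    · rw [hΔ1]; exact h1
    · rw [hΔ2]; exact h2
    · rw [hΔ3]; exact h3
    · rw [hΔ4, hΔ3]; exact mul_pos h0 h3

/-- **Hairer–Nørsett–Wanner (13.13): the quartic `z⁴ + pz³ + qz² + rz + s` has all its roots in `Re z < 0` iff `p > 0`, `pq − r > 0`, `(pq − r)r − p²s > 0`, `s > 0`.**
[HNW I §I.13 (13.13) (Routh 1877, p. 27); this file, §927] -/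
theorem forall_re_neg_quartic_iff (p q r s : ℝ) :
    (∀ z ∈ ((Polynomial.X ^ 4 + C p * Polynomial.X ^ 3 + C q * Polynomial.X ^ 2 + C r * Polynomial.X + C s : ℝ[X]).map (algebraMap ℝ ℂ)).roots, z.re < 0) ↔
      0 < p ∧ 0 < p * q - r ∧ 0 < (p * q - r) * r - p ^ 2 * s ∧ 0 < s := by
  set P : ℝ[X] := Polynomial.X ^ 4 + C p * Polynomial.X ^ 3 + C q * Polynomial.X ^ 2 + C r * Polynomial.X + C s with hP
  have hc : ∀ k, P.coeff k = if k = 4 then 1 else if k = 3 then p else if k = 2 then q else if k = 1 then r else if k = 0 then s else 0 := fun k => by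
    simp only [hP, coeff_add, coeff_C_mul, coeff_X_pow, coeff_X, coeff_C]
    split_ifs <;> first | omega | simp only [mul_one, mul_zero, add_zero, zero_add]
  have h4 : P.coeff 4 = 1 := by rw [hc]; simp
  have h3 : P.coeff 3 = p := by rw [hc]; simp
  have h2 : P.coeff 2 = q := by rw [hc]; simp
  have h1 : P.coeff 1 = r := by rw [hc]; simp
  have h0 : P.coeff 0 = s := by rw [hc]; simp
  have hdeg : P.natDegree = 4 := by
    refine le_antisymm ?_ (le_natDegree_of_ne_zero (by rw [h4]; exact one_ne_zero))
    rw [natDegree_le_iff_coeff_eq_zero]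
    intro k hk
    rw [hc]
    split_ifs <;> first | omega | rfl
  rw [forall_re_neg_iff_of_natDegree_four hdeg (by rw [h4]; exact one_pos), h4, h3, h2, h1, h0, one_mul]

end Summit.Ventures.HSemireg.Wedge.HankelOuter
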